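import Mathlib
import Summits.AnomalousDissipation.AnomalousDissipation.Theses.WazewskiBlock
import Summits.AnomalousDissipation.AnomalousDissipation.Theorems.WazewskiBlockUniformWorkFloorTrapLoadBearing
import Summits.AnomalousDissipation.AnomalousDissipation.Theorems.WazewskiBlockUniformWorkFloorTrapGalerkinCyclePersistence
import Literature.Analysis.FunctionSpaces.TorusLinearisedFormTruncation
import HarnessLib

/-!
# Route `WazewskiBlock`, crux `UniformWorkFloorTrap` (stmt-AnomalousDissipation-10353), line
# `work-lipschitz-cycles`: the crux from ν-uniformly loud bounded nondegenerate cycles (conditional bridge)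

Definition-free proof file (lead a1).  The composition of the line skeleton
`Cruxes/UniformWorkFloorTrap/Lines/work_lipschitz_cycles.lean` with its conjecture-class core turned
into a HYPOTHESIS: if one mean-zero Galerkin-mode force `f` carries, for every small viscosity, a
classical time-periodic solution of `NS_ν(f)` in the mean-zero leaf with simple Floquet multiplier
`1` and ν-free pointwise margins `kineticEnergy ≤ E`, `(f, u t) ≥ 2ε₁` (the registered core stub
`stub_loudNondegenerateCycles`, open — a structured pointwise zeroth law), then
`WazewskiBlock.UniformWorkFloorTrap` holds: Galerkin persistence at fixed `ν`
(`stub_galerkinCyclePersistence`, PROVED), `L²`-robustness of the block's margins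
(`margins_of_sq_dist_le`), closeness over one period is closeness forever
(`sq_dist_le_of_periodic`), and the orbit form of the crux (`uniformWorkFloorTrap_iff_orbit`, p107806).
Kernel-checked consequence: any refutation of the crux refutes the core for every force.
-/

noncomputable section

-- `Summit.<Summit>.<Problem>`: single-conjunct summit, the duplicate namespace is mandated (CONVENTIONS §2).
set_option linter.dupNamespace false

namespace Summit.AnomalousDissipation.AnomalousDissipation.Theorems.UniformWorkFloorTrap.WorkLipschitzCycles

open scoped InnerProductSpace Topology
open MeasureTheory Filter Set Function UnitAddTorus
open Literature.Analysis.FunctionSpaces Literature.Analysis.FunctionSpaces.Torus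
open Literature.Analysis.FluidPDE
open Summit.AnomalousDissipation.AnomalousDissipation.Theses.WazewskiBlock (UniformWorkFloorTrap)
open Summit.AnomalousDissipation.AnomalousDissipation.Theorems.UniformWorkFloorTrap
  (uniformWorkFloorTrap_iff_orbit)

/-! ## `L²`-robustness of the margins and periodic bookkeeping -/

/-- **The block's margins are `L²`-robust** (the C⁰-closeness step of the card, proved): for smooth
fields `f, v, w` on `T³` with `kineticEnergy w ≤ E`, `(f, w) ≥ W₀` and `∫‖v − w‖² ≤ δ`, one has
`kineticEnergy v ≤ 2E + δ` (from `‖v‖² ≤ 2‖w‖² + 2‖v − w‖²`) and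
`(f, v) ≥ W₀ − (∫‖f‖²)^{1/2} δ^{1/2}` (Cauchy–Schwarz, `Literature.Analysis.FluidPDE.abs_integral_inner_le_sqrt_mul_sqrt`). -/
theorem margins_of_sq_dist_le {f v w : UnitAddTorus (Fin 3) → EuclideanSpace ℝ (Fin 3)} {E W₀ δ : ℝ} (hf : IsSmooth f) (hv : IsSmooth v)
    (hw : IsSmooth w) (hE : kineticEnergy w ≤ E) (hW : W₀ ≤ ∫ x, ⟪f x, w x⟫_ℝ)
    (hδ : ∫ x, ‖v x - w x‖ ^ 2 ≤ δ) :
    kineticEnergy v ≤ 2 * E + δ ∧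
      W₀ - Real.sqrt (∫ x, ‖f x‖ ^ 2) * Real.sqrt δ ≤ ∫ x, ⟪f x, v x⟫_ℝ := by
  have hvw : IsSmooth (fun x => v x - w x) := hv.sub hw
  have hiv : Integrable (fun x => ‖v x‖ ^ 2) volume := hv.norm_sq.integrable
  have hiw : Integrable (fun x => ‖w x‖ ^ 2) volume := hw.norm_sq.integrable
  have hivw : Integrable (fun x => ‖v x - w x‖ ^ 2) volume := hvw.norm_sq.integrable
  have hδ0 : 0 ≤ δ := le_trans (integral_nonneg fun x => sq_nonneg _) hδ
  constructor
  · -- energy: `∫‖v‖² ≤ 2∫‖w‖² + 2∫‖v - w‖² ≤ 4E + 2δ`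
    have hpt : ∀ x, ‖v x‖ ^ 2 ≤ 2 * ‖w x‖ ^ 2 + 2 * ‖v x - w x‖ ^ 2 := by
      intro x
      have h1 : ‖v x‖ ≤ ‖w x‖ + ‖v x - w x‖ := by
        calc ‖v x‖ = ‖w x + (v x - w x)‖ := by congr 1; abel
          _ ≤ ‖w x‖ + ‖v x - w x‖ := norm_add_le _ _
      have h4 : 0 ≤ ‖v x‖ := norm_nonneg _
      have h5 : ‖v x‖ ^ 2 ≤ (‖w x‖ + ‖v x - w x‖) ^ 2 := pow_le_pow_left₀ h4 h1 2
      nlinarith [sq_nonneg (‖w x‖ - ‖v x - w x‖)]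
    have hint : ∫ x, ‖v x‖ ^ 2 ≤ ∫ x, (2 * ‖w x‖ ^ 2 + 2 * ‖v x - w x‖ ^ 2) :=
      integral_mono hiv ((hiw.const_mul 2).add (hivw.const_mul 2)) hpt
    have hsplit : ∫ x, (2 * ‖w x‖ ^ 2 + 2 * ‖v x - w x‖ ^ 2) =
        2 * (∫ x, ‖w x‖ ^ 2) + 2 * ∫ x, ‖v x - w x‖ ^ 2 := by
      rw [integral_add (hiw.const_mul 2) (hivw.const_mul 2), integral_const_mul, integral_const_mul]
    have hKEw : 2⁻¹ * ∫ x, ‖w x‖ ^ 2 ≤ E := hE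
    show 2⁻¹ * ∫ x, ‖v x‖ ^ 2 ≤ 2 * E + δ
    nlinarith [hint, hsplit, hKEw, hδ]
  · -- work: `∫⟪f, v⟫ = ∫⟪f, w⟫ + ∫⟪f, v - w⟫ ≥ W₀ - ‖f‖‖v - w‖`
    have hifw : Integrable (fun x => ⟪f x, w x⟫_ℝ) volume := (hf.inner hw).integrable
    have hifvw : Integrable (fun x => ⟪f x, v x - w x⟫_ℝ) volume := (hf.inner hvw).integrable
    have hsum : ∫ x, ⟪f x, v x⟫_ℝ = (∫ x, ⟪f x, w x⟫_ℝ) + ∫ x, ⟪f x, v x - w x⟫_ℝ := by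
      rw [← integral_add hifw hifvw]
      congr 1; funext x
      rw [← inner_add_right]; congr 1; abel
    have hcs := abs_integral_inner_le_sqrt_mul_sqrt (hf.memLp 2) (hvw.memLp 2)
    have hsq : Real.sqrt (∫ x, ‖v x - w x‖ ^ 2) ≤ Real.sqrt δ := Real.sqrt_le_sqrt hδ
    have hf0 : 0 ≤ Real.sqrt (∫ x, ‖f x‖ ^ 2) := Real.sqrt_nonneg _
    have hlow : -(Real.sqrt (∫ x, ‖f x‖ ^ 2) * Real.sqrt δ) ≤ ∫ x, ⟪f x, v x - w x⟫_ℝ := by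
      have := (abs_le.1 hcs).1
      nlinarith [mul_le_mul_of_nonneg_left hsq hf0]
    linarith

/-- **A periodic point of the Galerkin semiflow returns at every multiple of its period**
(`galerkinFlow_add`, induction). -/
theorem galerkinFlow_nat_mul_period {ν : ℝ} {N : ℕ} {f a : UnitAddTorus (Fin 3) → EuclideanSpace ℝ (Fin 3)} {τ' : ℝ}
    (ha : IsGalerkinMode N a) (hν : 0 ≤ ν) (hf : Integrable f volume) (hτ' : 0 ≤ τ')
    (hper : Torus.galerkinFlow ν f N τ' a = a) (k : ℕ) :
    Torus.galerkinFlow ν f N (k * τ') a = a := by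
  induction k with
  | zero => simp
  | succ k ih =>
    have hk : (0 : ℝ) ≤ k * τ' := mul_nonneg (Nat.cast_nonneg k) hτ'
    rw [Nat.cast_succ, add_mul, one_mul, ha.galerkinFlow_add hν hf hk hτ', hper, ih]

/-- **Closeness over one period is closeness forever.** If the `galerkinFlow` orbit of the
`τ'`-periodic point `a` is `δ`-close in `L²` to the rescaled `τ`-periodic `u` on `[0, τ']`, it is so
for all `t ≥ 0` (write `t = s + k τ'`, `s ∈ [0, τ']`; semigroup law + `galerkinFlow_nat_mul_period`
on the Galerkin side, `Function.Periodic.nat_mul` on the PDE side). -/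
theorem sq_dist_le_of_periodic {ν τ τ' δ : ℝ} {N : ℕ} {f a : UnitAddTorus (Fin 3) → EuclideanSpace ℝ (Fin 3)} {u : ℝ → UnitAddTorus (Fin 3) → EuclideanSpace ℝ (Fin 3)}
    (ha : IsGalerkinMode N a) (hν : 0 ≤ ν) (hf : Integrable f volume) (hτ' : 0 < τ')
    (hu : Function.Periodic u τ) (hper : Torus.galerkinFlow ν f N τ' a = a)
    (hclose : ∀ t ∈ Set.Icc (0 : ℝ) τ',
      ∫ x, ‖Torus.galerkinFlow ν f N t a x - u (τ / τ' * t) x‖ ^ 2 ≤ δ) :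
    ∀ t : ℝ, 0 ≤ t → ∫ x, ‖Torus.galerkinFlow ν f N t a x - u (τ / τ' * t) x‖ ^ 2 ≤ δ := by
  intro t ht
  -- the last return time `k τ' ≤ t < (k + 1) τ'`
  set k : ℕ := ⌊t / τ'⌋₊ with hk
  have hk1 : (k : ℝ) ≤ t / τ' := Nat.floor_le (div_nonneg ht hτ'.le)
  have hk2 : t / τ' < k + 1 := Nat.lt_floor_add_one (t / τ')
  have hkT : (k : ℝ) * τ' ≤ t := by
    have := mul_le_mul_of_nonneg_right hk1 hτ'.le
    rwa [div_mul_cancel₀ t hτ'.ne'] at this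
  have htT : t < (k + 1) * τ' := by
    have := mul_lt_mul_of_pos_right hk2 hτ'
    rwa [div_mul_cancel₀ t hτ'.ne'] at this
  set s : ℝ := t - k * τ' with hs
  have hs0 : 0 ≤ s := by rw [hs]; linarith
  have hs1 : s ≤ τ' := by rw [hs]; nlinarith
  have hkτ : (0 : ℝ) ≤ k * τ' := mul_nonneg (Nat.cast_nonneg k) hτ'.le
  have ht_eq : t = s + k * τ' := by rw [hs]; ring
  have hflow : Torus.galerkinFlow ν f N t a = Torus.galerkinFlow ν f N s a := by
    rw [ht_eq, ha.galerkinFlow_add hν hf hs0 hkτ, galerkinFlow_nat_mul_period ha hν hf hτ'.le hper k]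
  have hu_eq : u (τ / τ' * t) = u (τ / τ' * s) := by
    have harith : τ / τ' * t = τ / τ' * s + k * τ := by
      rw [ht_eq]; field_simp
    rw [harith]
    exact hu.nat_mul k (τ / τ' * s)
  rw [hflow, hu_eq]
  exact hclose s ⟨hs0, hs1⟩

/-! ## The composition -/

/-- **The crux follows from the core** (conditional bridge of line `work-lipschitz-cycles`, kernel-checked): From `stub_loudNondegenerateCycles` take
`(m, f, E, ε₁, ν₀)`; at `0 < ν ≤ ν₀` take the nondegenerate loud bounded cycle `(τ, u, p)`; with
`δ = ε₁² / (∫‖f‖² + 1)` the persistence stub gives `N₀(ν)` and, for `N ≥ N₀`, a Galerkin mode `a` whose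
`galerkinFlow` orbit is `δ`-close in `L²` to the (time-rescaled) cycle for all `t ≥ 0`; by
`margins_of_sq_dist_le` the orbit stays in `{kineticEnergy ≤ 2E + δ} ∩ {(f, ·) ≥ ε₁}` — hence in the
block with the ν-free constants `E' = 2E + ε₁² `, `ε₀ = ε₁` — and `uniformWorkFloorTrap_iff_orbit`
(p107806) turns the trapped orbit into the crux's trajectory clauses. -/
theorem uniformWorkFloorTrap_of_loudNondegenerateCycles :
    (∃ (m : ℕ) (f : UnitAddTorus (Fin 3) → EuclideanSpace ℝ (Fin 3)), IsGalerkinMode m f ∧ HasZeroMean f ∧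
      ∃ (E ε₁ ν₀ : ℝ), 0 < ε₁ ∧ 0 < ν₀ ∧ ∀ ν : ℝ, 0 < ν → ν ≤ ν₀ →
      ∃ (τ : ℝ) (u : ℝ → UnitAddTorus (Fin 3) → EuclideanSpace ℝ (Fin 3)) (p : ℝ → UnitAddTorus (Fin 3) → ℝ), 0 < τ ∧
      Torus.IsClassicalNSSolutionOn Set.univ ν (fun _ => f) u p ∧ Function.Periodic u τ ∧
      (∀ t, HasZeroMean (u t)) ∧
      (∀ (w : ℝ → UnitAddTorus (Fin 3) → EuclideanSpace ℂ (Fin 3)) (q : ℝ → UnitAddTorus (Fin 3) → ℂ),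
      Torus.IsSmoothSpaceTimeOn Set.univ w → Torus.IsSmoothSpaceTimeOn Set.univ q →
      (∀ t, Torus.IsDivFreeC (w t)) → (∀ t, HasZeroMean (w t)) → Function.Periodic w τ →
      (∀ t x, Torus.timeDerivWithin Set.univ w t x =
      Torus.linearizedNSOperator ν (u t) (w t) (q t) x) →
      ∃ z : ℂ, ∀ t x, w t x =
      z • Torus.realToComplex (Torus.timeDerivWithin Set.univ u t x)) ∧
      (∀ (w : ℝ → UnitAddTorus (Fin 3) → EuclideanSpace ℂ (Fin 3)) (q : ℝ → UnitAddTorus (Fin 3) → ℂ),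
      Torus.IsSmoothSpaceTimeOn Set.univ w → Torus.IsSmoothSpaceTimeOn Set.univ q →
      (∀ t, Torus.IsDivFreeC (w t)) → (∀ t, HasZeroMean (w t)) → Function.Periodic w τ →
      ∃ t x, Torus.timeDerivWithin Set.univ w t x ≠
      Torus.linearizedNSOperator ν (u t) (w t) (q t) x +
      Torus.realToComplex (Torus.timeDerivWithin Set.univ u t x)) ∧
      (∀ t, kineticEnergy (u t) ≤ E ∧ 2 * ε₁ ≤ ∫ x, ⟪f x, u t x⟫_ℝ)) →
    UniformWorkFloorTrap := by
  intro hcore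
  obtain ⟨m, f, hf, hf0, E, ε₁, ν₀, hε₁, hν₀, H⟩ := hcore
  rw [uniformWorkFloorTrap_iff_orbit]
  -- the `L²` tolerance, chosen once for all `ν`
  set F : ℝ := ∫ x, ‖f x‖ ^ 2 with hFdef
  have hF0 : 0 ≤ F := integral_nonneg fun x => sq_nonneg _
  set δ : ℝ := ε₁ ^ 2 / (F + 1) with hδdef
  have hδ0 : 0 < δ := div_pos (pow_pos hε₁ 2) (by linarith)
  have hδ1 : δ ≤ ε₁ ^ 2 := by
    rw [hδdef, div_le_iff₀ (by linarith : (0 : ℝ) < F + 1)]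
    nlinarith [pow_pos hε₁ 2]
  have hδF : Real.sqrt F * Real.sqrt δ ≤ ε₁ := by
    rw [← Real.sqrt_mul hF0]
    calc Real.sqrt (F * δ) ≤ Real.sqrt (ε₁ ^ 2) := by
            apply Real.sqrt_le_sqrt
            rw [hδdef, mul_div_assoc']
            rw [div_le_iff₀ (by linarith : (0 : ℝ) < F + 1)]
            nlinarith [pow_pos hε₁ 2]
      _ = ε₁ := Real.sqrt_sq hε₁.le
  refine ⟨m, f, hf, hf0, 2 * E + δ, ε₁, ν₀, hε₁, hν₀, fun ν hν hνν₀ => ?_⟩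
  obtain ⟨τ, u, p, hτ, hsol, hper, hmean, hker, hran, hB⟩ := H ν hν hνν₀
  obtain ⟨N₀, hN₀⟩ := stub_galerkinCyclePersistence ν τ m f u p hν hτ hf hf0 hsol hper hmean hker hran
    δ hδ0
  refine ⟨N₀, fun N hN => ?_⟩
  obtain ⟨a, τ', ha, hτ', hreturn, hclose1⟩ := hN₀ N hN
  have hclose := sq_dist_le_of_periodic ha hν.le hf.isSmooth.integrable hτ' hper hreturn hclose1
  refine ⟨a, ha, fun t ht => ?_⟩
  -- smoothness of the two slices being compared
  have hslice_u : IsSmooth (u (τ / τ' * t)) :=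
    hsol.smooth_velocity.isSmooth_slice (Set.mem_univ _)
  have hslice_a : IsSmooth (Torus.galerkinFlow ν f N t a) := (ha.isGalerkinMode_galerkinFlow t).isSmooth
  obtain ⟨hEu, hWu⟩ := hB (τ / τ' * t)
  obtain ⟨hKE, hW⟩ := margins_of_sq_dist_le hf.isSmooth hslice_a hslice_u hEu hWu (hclose t ht)
  refine ⟨hKE, ?_⟩
  have : 2 * ε₁ - Real.sqrt F * Real.sqrt δ ≤ ∫ x, ⟪f x, Torus.galerkinFlow ν f N t a x⟫_ℝ := hW
  linarith


end Summit.AnomalousDissipation.AnomalousDissipation.Theorems.UniformWorkFloorTrap.WorkLipschitzCycles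

end
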